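import Literature.AlgebraicTopology.Homotopy.CollaredDeformationRetract
import HarnessLib

/-!
# A collared subspace whose inclusion is a homotopy equivalence is a strong deformation retract

Topic `Literature/AlgebraicTopology/Homotopy`, sequel of `CollaredDeformationRetract.lean`. That
file proves: if `P = X' ∪ Y'` is a union of two closed pieces meeting along a collared subspace
`X' ∩ Y' = κ (A × {0})` (tree structure `Literature.AlgebraicTopology.Homotopy.CollaredCover`) and
`X'`, `Y'`, `A` are *contractible*, then `P` is contractible — the collared special case of
Hatcher's Cor. 0.20, proved by explicit formulas. Here the contractibility hypotheses on `A` and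
`Y'` are replaced by the hypothesis actually used in Hatcher's corollary: **the inclusion
`i : A → Y'`, `a ↦ κ (a, 0)`, is a homotopy equivalence.** Conclusion
(`CollaredCover.homotopyEquivLeftOfInclHomotopyInverse`): `P ≃ X'` is a homotopy equivalence
(indeed `Y'` strong deformation retracts onto `i (A)`), so `P` is contractible as soon as `X'` is
(`CollaredCover.contractibleSpace_of_inclHomotopyInverse`).

This is the homotopy theory in the sentence "If `Sⁿ` is a deformation retract of `W`, then it
clearly follows that `W'` is contractible" of Kervaire–Milnor, *Groups of homotopy spheres I*,
Ann. of Math. 77 (1963), proof of Lemma 2.3 (p. 506; `W' = W ∪_{Sⁿ} Dⁿ⁺¹`), for the modern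
definition of an h-cobordism (the inclusions of the ends are homotopy equivalences, Milnor,
*Lectures on the h-cobordism theorem* (1965), §1) in place of Kervaire–Milnor's ("both `M₁` and
`-M₂` are deformation retracts of `W`", §1 p. 505): the boundary of a compact smooth manifold is
collared, and a collared inclusion which is a homotopy equivalence is a strong deformation retract
(Hatcher, *Algebraic Topology* (2002), Prop. 0.19 and Cor. 0.20, with Example 0.15).

## Proof

Let `c : CollaredCover P A` with collar `κ = c.collar : A × [0,1] → P`, `Z := Y' = c.right`,
`i = c.incl`, and homotopy-inverse data `h` for `i` (`CollaredCover.InclHomotopyInverse`): a map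
`g : Z → A` and homotopies `G : g ∘ i ≃ id_A`, `F : i ∘ g ≃ id_Z`.
1. *Squeezing the lower half-collar.* `E' (κ (a, s)) = κ (a, max 0 (2s - 1))`, `E' = id` off the
   collar (`sqz`); `E' ≃ id` by `M_t (κ (a, s)) = κ (a, (1-t) max 0 (2s-1) + t s)` (`bigM`).
2. *Homotopy extension along the collar* (Hatcher, proof of Prop. 0.16 for the collared pair): the
   homotopy `G` of `g ∘ i` extends to `Ĝ_u : Z → A` with `Ĝ₀ = g`:
   `Ĝ_u (κ (a, σ)) = G_{u - 2σ} (a)` for `2σ ≤ u`, `= g (κ (a, (2σ - u)/(2 - u)))` for `2σ ≥ u`,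
   `Ĝ_u = g` off the collar (`hatG`). The **retraction** is `r := Ĝ₁ ∘ E'` (`retr'`):
   `r ∘ i = id` and `r (κ (a, s)) = a` for `s ≤ 1/2`.
3. A homotopy `k : i ∘ r ≃ id_Z` (`kFun'`): `i ∘ Ĝ_{1-u} ∘ E'` (from `i ∘ r` to `i ∘ g ∘ E'`),
   then `F_u ∘ E'` (to `E'`), then `M_u` (to `id`).
4. *Symmetrising the track* (Hatcher, proof of Prop. 0.19): `k'_t = k_{1-2t} ∘ i ∘ r` for
   `t ≤ 1/2`, `k'_t = k_{2t-1}` for `t ≥ 1/2` (`ksym`) is again a homotopy from `i ∘ r` to `id`,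
   and its track on `i a` is `Ω (m t, a)` with `Ω (m, a) = k_{1-m} (i a)`, `m t = min (2t) (2-2t)`
   and `Ω (0, a) = i a` (`trackΩ`, `ksym_incl`).
5. From here the argument of `CollaredDeformationRetract.lean` (steps 3–5 there) applies verbatim
   with the contraction `C_m (i a)` replaced by `Ω (m, a)`: straightening the track inside the
   collar gives `K : i ∘ r ≃ E` stationary on `i (A)` (`bigK'`), `L : E ≃ id` rel `i (A)` is the
   tree's `CollaredCover.bigL`, so `i ∘ r ≃ id` rel `i (A)`; extending by the identity of `X'`
   gives `P ≃ X'` (`dFun'`, `homotopyEquivLeftOfInclHomotopyInverse`).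

## References

* A. Hatcher, *Algebraic Topology*, CUP (2002), Ch. 0: Example 0.15, Prop. 0.16, Prop. 0.19,
  Cor. 0.20. [HatcherAT2002]
* M. Kervaire, J. Milnor, *Groups of homotopy spheres I*, Ann. of Math. (2) 77 (1963), §1
  (p. 505) and proof of Lemma 2.3 (p. 506). [KervaireMilnorAnnals1963]
* J. Milnor, *Lectures on the h-cobordism theorem*, Princeton (1965), §1. [MilnorHCobordism1965]

## Design notes

* Everything is in namespace `Literature.AlgebraicTopology.Homotopy.CollaredCover`; no named facts
  are introduced, nothing uses `sorry`. All homotopies are plain functions `[0,1] × _ → _`, glued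
  along the collar with the tree's `CollaredCover.glue`.
* `InclHomotopyInverse.ofHomotopyEquiv` builds the input from a Mathlib
  `ContinuousMap.HomotopyEquiv A c.right` whose forward map is `c.incl`.
-/

open Set Function Topology
open scoped unitInterval Topology

noncomputable section

namespace Literature.AlgebraicTopology.Homotopy

universe u v

attribute [local instance] Classical.propDecidable

namespace CollaredCover

variable {P : Type u} [TopologicalSpace P] {A : Type v} [TopologicalSpace A]
  (c : CollaredCover P A)

/-! ### Homotopy-inverse data for the inclusion `i : A → Y'` -/

/-- **Homotopy-inverse data for the inclusion `i : A → Y'`** of a collared cover: a map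
`g : Y' → A` with homotopies `G : g ∘ i ≃ id_A` and `F : i ∘ g ≃ id_{Y'}` (as jointly continuous
functions `[0,1] × _ → _`). Hatcher, *Algebraic Topology* (2002), Ch. 0, p. 3 (homotopy
equivalences). [folklore] -/
structure InclHomotopyInverse where
  /-- The homotopy inverse `g : Y' → A` of `i`. -/
  inv : c.right → A
  /-- `g` is continuous. -/
  continuous_inv : Continuous inv
  /-- The homotopy `G` from `g ∘ i` to `id_A`. -/
  homA : I → A → A
  /-- `G` is jointly continuous. -/
  continuous_homA : Continuous fun p : I × A => homA p.1 p.2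
  /-- `G₀ = g ∘ i`. -/
  homA_zero : ∀ a, homA 0 a = inv (c.incl a)
  /-- `G₁ = id`. -/
  homA_one : ∀ a, homA 1 a = a
  /-- The homotopy `F` from `i ∘ g` to `id_{Y'}`. -/
  homR : I → c.right → c.right
  /-- `F` is jointly continuous. -/
  continuous_homR : Continuous fun p : I × c.right => homR p.1 p.2
  /-- `F₀ = i ∘ g`. -/
  homR_zero : ∀ z, homR 0 z = c.incl (inv z)
  /-- `F₁ = id`. -/
  homR_one : ∀ z, homR 1 z = z

/-- Homotopy-inverse data from a Mathlib homotopy equivalence `A ≃ₕ Y'` whose forward map is the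
inclusion `i`. [folklore] -/
def InclHomotopyInverse.ofHomotopyEquiv (e : ContinuousMap.HomotopyEquiv A c.right)
    (he : ∀ a, e.toFun a = c.incl a) : c.InclHomotopyInverse where
  inv := e.invFun
  continuous_inv := e.invFun.continuous
  homA t a := e.left_inv.some (t, a)
  continuous_homA := e.left_inv.some.continuous
  homA_zero a := by
    rw [e.left_inv.some.apply_zero, ContinuousMap.comp_apply, he]
  homA_one a := by
    rw [e.left_inv.some.apply_one, ContinuousMap.id_apply]
  homR t z := e.right_inv.some (t, z)
  continuous_homR := e.right_inv.some.continuous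
  homR_zero z := by
    rw [e.right_inv.some.apply_zero, ContinuousMap.comp_apply, he]
  homR_one z := by
    rw [e.right_inv.some.apply_one, ContinuousMap.id_apply]

variable [Nonempty A]

/-! ### Step 1: squeezing the lower half of the collar -/

/-- **The squeeze `E'`**: `E' (κ (a, s)) = κ (a, max 0 (2s - 1))`, `E' = id` off the collar.
[folklore] -/
def sqz : c.right → c.right :=
  c.glue (T := Unit) (fun _ q => c.collarR (q.1, clampI (2 * (q.2 : ℝ) - 1))) (fun _ z => z) ()

omit [Nonempty A] in
/-- The two definitions of `E'` agree on the top of the collar. [folklore] -/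
theorem sqz_agree (a : A) : c.collarR (a, clampI (2 * ((1 : I) : ℝ) - 1)) = c.collarR (a, 1) := by
  norm_num

/-- `E'` on the collar. [folklore] -/
theorem sqz_collarR (a : A) (s : I) :
    c.sqz (c.collarR (a, s)) = c.collarR (a, clampI (2 * (s : ℝ) - 1)) := by
  rw [sqz, glue_collarR]

/-- `E'` collapses the lower half of the collar onto `i (A)`. [folklore] -/
theorem sqz_collarR_of_le (a : A) {s : I} (hs : (s : ℝ) ≤ 1 / 2) :
    c.sqz (c.collarR (a, s)) = c.incl a := by
  rw [sqz_collarR, clampI_of_nonpos (by linarith), incl_eq]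

/-- `E' ∘ i = i`. [folklore] -/
@[simp] theorem sqz_incl (a : A) : c.sqz (c.incl a) = c.incl a :=
  c.sqz_collarR_of_le a (by simp)

/-- `E'` is the identity off the open collar. [folklore] -/
theorem sqz_of_not_mem {z : c.right} (hz : (z : P) ∉ c.collar '' {q | q.2 < 1}) : c.sqz z = z := by
  rw [sqz, c.glue_of_not_mem (fun _ a => c.sqz_agree a) () hz]

/-- `E'` is continuous. [folklore] -/
theorem continuous_sqz : Continuous c.sqz := by
  have h := c.continuous_glue (T := Unit)
    (F₁ := fun _ q => c.collarR (q.1, clampI (2 * (q.2 : ℝ) - 1))) (F₂ := fun _ z => z)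
    (c.continuous_collarR.comp ((continuous_fst.comp continuous_snd).prodMk
      (continuous_clampI.comp ((continuous_const.mul
        (continuous_subtype_val.comp (continuous_snd.comp continuous_snd))).sub continuous_const))))
    continuous_snd (fun _ a => c.sqz_agree a)
  exact h.comp (Continuous.prodMk_right ())

/-- **The homotopy `M`** from `E'` to `id`: `M_t (κ (a, s)) = κ (a, (1 - t) max 0 (2s-1) + t s)`,
`M = id` off the collar. [folklore] -/
def bigM : I → c.right → c.right :=
  c.glue (fun t q => c.collarR (q.1,
    clampI ((1 - (t : ℝ)) * (clampI (2 * (q.2 : ℝ) - 1) : ℝ) + t * q.2))) (fun _ z => z)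

omit [Nonempty A] in
/-- The two definitions of `M` agree on the top of the collar. [folklore] -/
theorem bigM_agree (t : I) (a : A) :
    c.collarR (a, clampI ((1 - (t : ℝ)) * (clampI (2 * ((1 : I) : ℝ) - 1) : ℝ) + t * (1 : I))) =
      c.collarR (a, 1) := by
  norm_num

/-- `M` is jointly continuous. [folklore] -/
theorem continuous_bigM : Continuous fun p : I × c.right => c.bigM p.1 p.2 := by
  refine c.continuous_glue ?_ continuous_snd c.bigM_agree
  refine c.continuous_collarR.comp ((continuous_fst.comp continuous_snd).prodMk
    (continuous_clampI.comp ?_))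
  exact ((continuous_const.sub (continuous_subtype_val.comp continuous_fst)).mul
    (continuous_subtype_val.comp (continuous_clampI.comp ((continuous_const.mul
      (continuous_subtype_val.comp (continuous_snd.comp continuous_snd))).sub
        continuous_const)))).add
    ((continuous_subtype_val.comp continuous_fst).mul
      (continuous_subtype_val.comp (continuous_snd.comp continuous_snd)))

/-- `M_0 = E'`. [folklore] -/
theorem bigM_zero (z : c.right) : c.bigM 0 z = c.sqz z := by
  rcases c.collarR_or_not_mem z with ⟨⟨a, s⟩, rfl⟩ | hz
  · rw [bigM, glue_collarR, sqz_collarR]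
    simp
  · rw [bigM, c.glue_of_not_mem c.bigM_agree 0 hz, c.sqz_of_not_mem hz]

/-- `M_1 = id`. [folklore] -/
theorem bigM_one (z : c.right) : c.bigM 1 z = z := by
  rcases c.collarR_or_not_mem z with ⟨⟨a, s⟩, rfl⟩ | hz
  · rw [bigM, glue_collarR]
    simp
  · rw [bigM, c.glue_of_not_mem c.bigM_agree 1 hz]

/-! ### Step 2: homotopy extension along the collar and the retraction `r` -/

variable (h : c.InclHomotopyInverse)

/-- **The extended homotopy `Ĝ` in collar coordinates**: `Ĝ_u (a, σ) = G_{u-2σ} (a)` for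
`2σ ≤ u` and `g (κ (a, (2σ - u)/(2 - u)))` for `2σ ≥ u` (Hatcher 2002, proof of Prop. 0.16: the
retraction of `Z × I` onto `Z × {0} ∪ A × I` along a collar). [folklore] -/
def hatGCollar (u : I) (q : A × I) : A :=
  if 2 * (q.2 : ℝ) ≤ u then h.homA (clampI ((u : ℝ) - 2 * q.2)) q.1
  else h.inv (c.collarR (q.1, clampI ((2 * (q.2 : ℝ) - u) / (2 - u))))

omit [Nonempty A] in
/-- On the top of the collar `Ĝ_u` is `g`. [folklore] -/
theorem hatGCollar_agree (u : I) (a : A) :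
    c.hatGCollar h u (a, 1) = h.inv (c.collarR (a, 1)) := by
  have hu : (u : ℝ) ≤ 1 := u.2.2
  have h2 : ¬ (2 * ((1 : I) : ℝ) ≤ u) := by norm_num; linarith
  rw [hatGCollar, if_neg h2]
  have hne : (2 : ℝ) - u ≠ 0 := by linarith
  have : (2 * ((1 : I) : ℝ) - u) / (2 - u) = 1 := by
    rw [Set.Icc.coe_one, mul_one, div_self hne]
  rw [this, clampI_one]

omit [Nonempty A] in
/-- `Ĝ` is jointly continuous in collar coordinates. [folklore] -/
theorem continuous_hatGCollar : Continuous fun p : I × (A × I) => c.hatGCollar h p.1 p.2 := by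
  refine Continuous.if_le ?_ ?_
    (continuous_const.mul (continuous_subtype_val.comp (continuous_snd.comp continuous_snd)))
    (continuous_subtype_val.comp continuous_fst) ?_
  · exact h.continuous_homA.comp ((continuous_clampI.comp
      ((continuous_subtype_val.comp continuous_fst).sub (continuous_const.mul
        (continuous_subtype_val.comp (continuous_snd.comp continuous_snd))))).prodMk
      (continuous_fst.comp continuous_snd))
  · refine h.continuous_inv.comp (c.continuous_collarR.comp
      ((continuous_fst.comp continuous_snd).prodMk (continuous_clampI.comp ?_)))
    refine Continuous.div ?_ ?_ ?_
    · exact (continuous_const.mul (continuous_subtype_val.comp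
        (continuous_snd.comp continuous_snd))).sub (continuous_subtype_val.comp continuous_fst)
    · exact continuous_const.sub (continuous_subtype_val.comp continuous_fst)
    · rintro ⟨u, q⟩
      have hu : (u : ℝ) ≤ 1 := u.2.2
      show (2 : ℝ) - u ≠ 0
      linarith
  · rintro ⟨u, a, s⟩ (hs : 2 * (s : ℝ) = u)
    simp only [hs, sub_self, zero_div, clampI_zero]
    rw [h.homA_zero, incl_eq]

/-- **The extended homotopy `Ĝ : [0,1] × Y' → A`**: `hatGCollar` on the collar, `g` off it.
[folklore] -/
def hatG : I → c.right → A := c.glue (c.hatGCollar h) (fun _ z => h.inv z)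

/-- `Ĝ` is jointly continuous. [folklore] -/
theorem continuous_hatG : Continuous fun p : I × c.right => c.hatG h p.1 p.2 :=
  c.continuous_glue (c.continuous_hatGCollar h) (h.continuous_inv.comp continuous_snd)
    (c.hatGCollar_agree h)

/-- `Ĝ₀ = g`. [folklore] -/
theorem hatG_zero (z : c.right) : c.hatG h 0 z = h.inv z := by
  rcases c.collarR_or_not_mem z with ⟨⟨a, s⟩, rfl⟩ | hz
  · rw [hatG, glue_collarR, hatGCollar]
    split_ifs with hs
    · have hs' : 2 * (s : ℝ) ≤ 0 := by simpa using hs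
      have hs0 : (s : ℝ) = 0 := le_antisymm (by linarith) s.2.1
      have : s = 0 := Subtype.ext hs0
      subst this
      simp [h.homA_zero, incl_eq]
    · congr 2
      simp
  · rw [hatG, c.glue_of_not_mem (c.hatGCollar_agree h) 0 hz]

/-- `Ĝ₁ (i a) = G₁ (a) = a`. [folklore] -/
theorem hatG_one_incl (a : A) : c.hatG h 1 (c.incl a) = a := by
  rw [hatG, glue_incl, hatGCollar, if_pos (by norm_num)]
  simp [h.homA_one]

/-- **The retraction** `r = Ĝ₁ ∘ E' : Y' → A`. [folklore] -/
def retr' (z : c.right) : A := c.hatG h 1 (c.sqz z)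

/-- `r` is continuous. [folklore] -/
theorem continuous_retr' : Continuous (c.retr' h) :=
  (c.continuous_hatG h).comp ((Continuous.prodMk_right (1 : I)).comp c.continuous_sqz)

/-- `r (κ (a, s)) = a` for `s ≤ 1/2`. [folklore] -/
theorem retr'_collarR_of_le (a : A) {s : I} (hs : (s : ℝ) ≤ 1 / 2) :
    c.retr' h (c.collarR (a, s)) = a := by
  rw [retr', c.sqz_collarR_of_le a hs, hatG_one_incl]

/-- `r ∘ i = id`. [folklore] -/
@[simp] theorem retr'_incl (a : A) : c.retr' h (c.incl a) = a :=
  c.retr'_collarR_of_le h a (by simp)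

/-! ### Step 3: a homotopy `k` from `i ∘ r` to the identity -/

/-- Stage 1 of `k`: `u ↦ i ∘ Ĝ_{1-u} ∘ E'`, from `i ∘ r` to `i ∘ g ∘ E'`. [folklore] -/
def stage1 (u : I) (z : c.right) : c.right := c.incl (c.hatG h (clampI (1 - (u : ℝ))) (c.sqz z))

/-- Stage 2 of `k`: `u ↦ F_u ∘ E'`, from `i ∘ g ∘ E'` to `E'`. [folklore] -/
def stage2 (u : I) (z : c.right) : c.right := h.homR u (c.sqz z)

/-- Stage 1 is jointly continuous. [folklore] -/
theorem continuous_stage1 : Continuous fun p : I × c.right => c.stage1 h p.1 p.2 :=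
  c.continuous_incl.comp ((c.continuous_hatG h).comp
    ((continuous_clampI.comp (continuous_const.sub (continuous_subtype_val.comp continuous_fst))).prodMk
      (c.continuous_sqz.comp continuous_snd)))

/-- Stage 2 is jointly continuous. [folklore] -/
theorem continuous_stage2 : Continuous fun p : I × c.right => c.stage2 h p.1 p.2 :=
  h.continuous_homR.comp (continuous_fst.prodMk (c.continuous_sqz.comp continuous_snd))

/-- **The homotopy `k`** from `i ∘ r` to `id`: stage 1 on `[0, 1/2]`, stage 2 on `[1/2, 3/4]`,
`M` on `[3/4, 1]`. [folklore] -/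
def kFun' (t : I) (z : c.right) : c.right :=
  if (t : ℝ) ≤ 1 / 2 then c.stage1 h (clampI (2 * t)) z
  else if (t : ℝ) ≤ 3 / 4 then c.stage2 h (clampI (4 * t - 2)) z else c.bigM (clampI (4 * t - 3)) z

/-- `k` is jointly continuous. [folklore] -/
theorem continuous_kFun' : Continuous fun p : I × c.right => c.kFun' h p.1 p.2 := by
  refine Continuous.if_le ?_ ?_ (continuous_subtype_val.comp continuous_fst) continuous_const ?_
  · exact (c.continuous_stage1 h).comp ((continuous_clampI.comp (continuous_const.mul
      (continuous_subtype_val.comp continuous_fst))).prodMk continuous_snd)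
  · refine Continuous.if_le ?_ ?_ (continuous_subtype_val.comp continuous_fst) continuous_const ?_
    · exact (c.continuous_stage2 h).comp ((continuous_clampI.comp ((continuous_const.mul
        (continuous_subtype_val.comp continuous_fst)).sub continuous_const)).prodMk continuous_snd)
    · exact c.continuous_bigM.comp ((continuous_clampI.comp ((continuous_const.mul
        (continuous_subtype_val.comp continuous_fst)).sub continuous_const)).prodMk continuous_snd)
    · rintro ⟨t, z⟩ (ht : (t : ℝ) = 3 / 4)
      simp only [ht]
      norm_num
      rw [stage2, h.homR_one, bigM_zero]
  · rintro ⟨t, z⟩ (ht : (t : ℝ) = 1 / 2)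
    simp only [ht]
    norm_num
    rw [stage1, stage2, clampI_of_nonpos (by norm_num), hatG_zero, h.homR_zero]

/-- `k_0 = i ∘ r`. [folklore] -/
@[simp] theorem kFun'_zero (z : c.right) : c.kFun' h 0 z = c.incl (c.retr' h z) := by
  simp [kFun', stage1, retr']

/-- `k_1 = id`. [folklore] -/
@[simp] theorem kFun'_one (z : c.right) : c.kFun' h 1 z = z := by
  rw [kFun', if_neg (by norm_num), if_neg (by norm_num)]
  norm_num
  exact c.bigM_one z

/-! ### Step 4: symmetrising the track on `i (A)` -/

/-- **The track `Ω`**: `Ω (m, a) = k_{1-m} (i a)`, so that `Ω (0, a) = i a`. [folklore] -/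
def trackΩ (m : I) (a : A) : c.right := c.kFun' h (clampI (1 - (m : ℝ))) (c.incl a)

/-- `Ω` is jointly continuous. [folklore] -/
theorem continuous_trackΩ : Continuous fun p : I × A => c.trackΩ h p.1 p.2 :=
  (c.continuous_kFun' h).comp ((continuous_clampI.comp (continuous_const.sub
    (continuous_subtype_val.comp continuous_fst))).prodMk (c.continuous_incl.comp continuous_snd))

/-- `Ω (0, a) = i a`. [folklore] -/
@[simp] theorem trackΩ_zero (a : A) : c.trackΩ h 0 a = c.incl a := by
  simp [trackΩ]

/-- **The symmetrised homotopy `k'`** from `i ∘ r` to `id`: `k'_t = k_{1-2t} ∘ i ∘ r` for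
`t ≤ 1/2` and `k'_t = k_{2t-1}` for `t ≥ 1/2` (Hatcher 2002, proof of Prop. 0.19). [folklore] -/
def ksym (t : I) (z : c.right) : c.right :=
  if (t : ℝ) ≤ 1 / 2 then c.kFun' h (clampI (1 - 2 * t)) (c.incl (c.retr' h z))
  else c.kFun' h (clampI (2 * t - 1)) z

/-- `k'` is jointly continuous. [folklore] -/
theorem continuous_ksym : Continuous fun p : I × c.right => c.ksym h p.1 p.2 := by
  refine Continuous.if_le ?_ ?_ (continuous_subtype_val.comp continuous_fst) continuous_const ?_
  · exact (c.continuous_kFun' h).comp ((continuous_clampI.comp (continuous_const.sub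
      (continuous_const.mul (continuous_subtype_val.comp continuous_fst)))).prodMk
      (c.continuous_incl.comp ((c.continuous_retr' h).comp continuous_snd)))
  · exact (c.continuous_kFun' h).comp ((continuous_clampI.comp ((continuous_const.mul
      (continuous_subtype_val.comp continuous_fst)).sub continuous_const)).prodMk continuous_snd)
  · rintro ⟨t, z⟩ (ht : (t : ℝ) = 1 / 2)
    simp only [ht]
    norm_num

/-- `k'_0 = i ∘ r`. [folklore] -/
@[simp] theorem ksym_zero (z : c.right) : c.ksym h 0 z = c.incl (c.retr' h z) := by
  simp [ksym]

/-- `k'_1 = id`. [folklore] -/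
@[simp] theorem ksym_one (z : c.right) : c.ksym h 1 z = z := by
  rw [ksym, if_neg (by norm_num)]
  norm_num

/-- The track of `k'` on `i a` is `Ω (m(t), a)`. [folklore] -/
theorem ksym_incl (t : I) (a : A) :
    c.ksym h t (c.incl a) = c.trackΩ h (clampI (loopProfile t)) a := by
  unfold ksym trackΩ
  split_ifs with ht
  · rw [retr'_incl, loopProfile_of_le ht,
      coe_clampI_of_mem ⟨by linarith [t.2.1], by linarith⟩]
  · have ht' : 1 / 2 ≤ (t : ℝ) := le_of_lt (not_le.1 ht)
    rw [loopProfile_of_ge ht', coe_clampI_of_mem ⟨by linarith [t.2.2], by linarith⟩]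
    congr 2
    ring

/-! ### Step 5: straightening the track inside the collar (as in `CollaredDeformationRetract`) -/

/-- **The collar part `G'` of the homotopy `K'`**: `G'_t (a, s) = Ω (4 s m(t), a)` for `s ≤ 1/4`
and `G'_t (a, s) = k'_t (κ (a, λ s))` for `s ≥ 1/4`. [folklore] -/
def gFun' (t : I) (q : A × I) : c.right :=
  if (q.2 : ℝ) ≤ 1 / 4 then c.trackΩ h (clampI (4 * q.2 * loopProfile t)) q.1
  else c.ksym h t (c.collarR (q.1, clampI (collarReparam q.2)))

/-- `G'` is jointly continuous. [folklore] -/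
theorem continuous_gFun' : Continuous fun p : I × (A × I) => c.gFun' h p.1 p.2 := by
  refine Continuous.if_le ?_ ?_ (continuous_subtype_val.comp (continuous_snd.comp continuous_snd))
    continuous_const ?_
  · exact (c.continuous_trackΩ h).comp ((continuous_clampI.comp ((continuous_const.mul
      (continuous_subtype_val.comp (continuous_snd.comp continuous_snd))).mul
      (continuous_loopProfile.comp (continuous_subtype_val.comp continuous_fst)))).prodMk
      (continuous_fst.comp continuous_snd))
  · exact (c.continuous_ksym h).comp (continuous_fst.prodMk (c.continuous_collarR.comp
      ((continuous_fst.comp continuous_snd).prodMk (continuous_clampI.comp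
        (continuous_collarReparam.comp (continuous_subtype_val.comp
          (continuous_snd.comp continuous_snd)))))))
  · rintro ⟨t, a, s⟩ (hs : (s : ℝ) = 1 / 4)
    simp only [hs, clampI_collarReparam_of_le le_rfl]
    rw [← incl_eq, ksym_incl]
    norm_num

/-- **The homotopy `K'`** from `i ∘ r` to `E`, stationary on `i (A)`: `G'` on the collar, `k'` off
it. [folklore] -/
def bigK' : I → c.right → c.right := c.glue (c.gFun' h) (c.ksym h)

/-- `G'` and `k'` agree on the top of the collar. [folklore] -/
theorem gFun'_one_eq (t : I) (a : A) : c.gFun' h t (a, 1) = c.ksym h t (c.collarR (a, 1)) := by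
  rw [gFun', if_neg (by norm_num)]
  simp

/-- `K'` is jointly continuous. [folklore] -/
theorem continuous_bigK' : Continuous fun p : I × c.right => c.bigK' h p.1 p.2 :=
  c.continuous_glue (c.continuous_gFun' h) (c.continuous_ksym h) (c.gFun'_one_eq h)

/-- `K'_0 = i ∘ r`. [folklore] -/
theorem bigK'_zero (z : c.right) : c.bigK' h 0 z = c.incl (c.retr' h z) := by
  rcases c.collarR_or_not_mem z with ⟨⟨a, s⟩, rfl⟩ | hz
  · rw [bigK', glue_collarR, gFun']
    split_ifs with hs
    · rw [show ((0 : I) : ℝ) = 0 from rfl, loopProfile_zero, mul_zero, clampI_zero, trackΩ_zero,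
        c.retr'_collarR_of_le h a (by linarith)]
    · rw [ksym_zero]
      congr 1
      by_cases h2 : (s : ℝ) ≤ 1 / 2
      · rw [c.retr'_collarR_of_le h a h2, c.retr'_collarR_of_le h a]
        linarith [two_mul_clampI_collarReparam_sub_one_nonpos h2]
      · rw [clampI_collarReparam_of_ge (le_of_lt (not_le.1 h2))]
  · rw [bigK', c.glue_of_not_mem (c.gFun'_one_eq h) 0 hz, ksym_zero]

/-- `K'_1 = E`. [folklore] -/
theorem bigK'_one (z : c.right) : c.bigK' h 1 z = c.eFun z := by
  rcases c.collarR_or_not_mem z with ⟨⟨a, s⟩, rfl⟩ | hz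
  · rw [bigK', glue_collarR, gFun', eFun, glue_collarR]
    split_ifs with hs
    · rw [show ((1 : I) : ℝ) = 1 from rfl, loopProfile_one, mul_zero, clampI_zero, trackΩ_zero,
        clampI_collarReparam_of_le hs, incl_eq]
    · rw [ksym_one]
  · rw [bigK', c.glue_of_not_mem (c.gFun'_one_eq h) 1 hz, ksym_one, eFun,
      c.glue_of_not_mem (fun _ a => by simp) () hz]

/-- `K'` is stationary on `i (A)`. [folklore] -/
theorem bigK'_incl (t : I) (a : A) : c.bigK' h t (c.incl a) = c.incl a := by
  rw [bigK', glue_incl, gFun', if_pos (by norm_num)]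
  simp

/-- **The strong deformation retraction of `Y'` onto `i (A)`**: `K'` followed by `L`.
[folklore] -/
def klFun' (t : I) (z : c.right) : c.right :=
  if (t : ℝ) ≤ 1 / 2 then c.bigK' h (clampI (2 * t)) z else c.bigL (clampI (2 * t - 1)) z

/-- The deformation is jointly continuous. [folklore] -/
theorem continuous_klFun' : Continuous fun p : I × c.right => c.klFun' h p.1 p.2 := by
  refine Continuous.if_le ?_ ?_ (continuous_subtype_val.comp continuous_fst) continuous_const ?_
  · exact (c.continuous_bigK' h).comp ((continuous_clampI.comp (continuous_const.mul
      (continuous_subtype_val.comp continuous_fst))).prodMk continuous_snd)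
  · exact c.continuous_bigL.comp ((continuous_clampI.comp ((continuous_const.mul
      (continuous_subtype_val.comp continuous_fst)).sub continuous_const)).prodMk continuous_snd)
  · rintro ⟨t, z⟩ (ht : (t : ℝ) = 1 / 2)
    simp only [ht]
    norm_num
    rw [bigK'_one, bigL_zero]

/-- At time `0` the deformation is `i ∘ r`. [folklore] -/
theorem klFun'_zero (z : c.right) : c.klFun' h 0 z = c.incl (c.retr' h z) := by
  simp [klFun', bigK'_zero]

/-- At time `1` the deformation is the identity. [folklore] -/
theorem klFun'_one (z : c.right) : c.klFun' h 1 z = z := by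
  rw [klFun', if_neg (by norm_num)]
  norm_num
  exact c.bigL_one z

/-- The deformation is stationary on `i (A)`. [folklore] -/
theorem klFun'_incl (t : I) (a : A) : c.klFun' h t (c.incl a) = c.incl a := by
  unfold klFun'
  split_ifs
  · exact c.bigK'_incl h _ a
  · exact c.bigL_incl _ a

/-- **`i (A)` is a strong deformation retract of `Y'`** (Hatcher 2002, Cor. 0.20, collared case):
the deformation `klFun'` is a homotopy from `i ∘ r` to `id` stationary on `i (A)`, packaged as a
jointly continuous function with its three defining properties. [cite: HatcherAT2002, Cor. 0.20] -/
theorem exists_deformation :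
    ∃ H : I × c.right → c.right, Continuous H ∧ (∀ z, H (0, z) = c.incl (c.retr' h z)) ∧
      (∀ z, H (1, z) = z) ∧ ∀ t a, H (t, c.incl a) = c.incl a :=
  ⟨fun p => c.klFun' h p.1 p.2, c.continuous_klFun' h, c.klFun'_zero h, c.klFun'_one h,
    c.klFun'_incl h⟩

/-- **The deformation of `P`**: the deformation of `Y'` extended by the identity on `X'`.
[folklore] -/
def dFun' (t : I) (p : P) : P := if hp : p ∈ c.right then (c.klFun' h t ⟨p, hp⟩ : P) else p

/-- On `X'` the deformation of `P` is the identity. [folklore] -/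
theorem dFun'_of_mem_left (t : I) {p : P} (hp : p ∈ c.left) : c.dFun' h t p = p := by
  unfold dFun'
  split_ifs with h'
  · obtain ⟨a, ha⟩ := c.exists_collar_zero_eq p ⟨hp, h'⟩
    have : (⟨p, h'⟩ : c.right) = c.incl a := Subtype.ext ha.symm
    rw [this, klFun'_incl, coe_incl, ha]
  · rfl

/-- At time `1` the deformation of `P` is the identity. [folklore] -/
theorem dFun'_one (p : P) : c.dFun' h 1 p = p := by
  unfold dFun'
  split_ifs with h'
  · rw [klFun'_one]
  · rfl

/-- At time `0` the deformation of `P` lands in `X'`. [folklore] -/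
theorem dFun'_zero_mem_left (p : P) : c.dFun' h 0 p ∈ c.left := by
  unfold dFun'
  split_ifs with h'
  · rw [klFun'_zero, coe_incl]
    exact c.collar_zero_mem_left _
  · have := c.union_eq ▸ mem_univ p
    exact this.resolve_right h'

/-- The deformation of `P` is jointly continuous (pasting the closed pieces `[0,1] × Y'` and
`[0,1] × X'`). [folklore] -/
theorem continuous_dFun' : Continuous fun x : I × P => c.dFun' h x.1 x.2 := by
  have hS : IsClosed ((univ : Set I) ×ˢ c.right) := isClosed_univ.prod c.isClosed_right
  have hS' : IsClosed ((univ : Set I) ×ˢ c.left) := isClosed_univ.prod c.isClosed_left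
  have h1 : ContinuousOn (fun x : I × P => c.dFun' h x.1 x.2) ((univ : Set I) ×ˢ c.right) := by
    rw [continuousOn_iff_continuous_restrict]
    have heq : ((univ : Set I) ×ˢ c.right).restrict (fun x : I × P => c.dFun' h x.1 x.2) =
        fun x => (c.klFun' h x.1.1 ⟨x.1.2, x.2.2⟩ : P) := by
      funext ⟨⟨t, p⟩, hx⟩
      simp only [restrict_apply, dFun', dif_pos hx.2]
    rw [heq]
    exact continuous_subtype_val.comp ((c.continuous_klFun' h).comp
      ((continuous_fst.comp continuous_subtype_val).prodMk
        ((continuous_snd.comp continuous_subtype_val).subtype_mk _)))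
  have h2 : ContinuousOn (fun x : I × P => c.dFun' h x.1 x.2) ((univ : Set I) ×ˢ c.left) :=
    continuousOn_snd.congr fun x hx => c.dFun'_of_mem_left h x.1 hx.2
  have h12 := h1.union_of_isClosed h2 hS hS'
  have huniv : (univ : Set I) ×ˢ c.right ∪ (univ : Set I) ×ˢ c.left = univ := by
    rw [← prod_union, union_comm, c.union_eq, univ_prod_univ]
  rw [huniv] at h12
  exact continuousOn_univ.1 h12

/-- **`P` is homotopy equivalent to its closed piece `X'`** when the inclusion of the seam into
the other piece `Y'` is a (collared) homotopy equivalence. Hatcher, *Algebraic Topology* (2002),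
Cor. 0.20 (collared case). [cite: HatcherAT2002, Cor. 0.20] -/
def homotopyEquivLeftOfInclHomotopyInverse : ContinuousMap.HomotopyEquiv P c.left where
  toFun := ⟨fun p => ⟨c.dFun' h 0 p, c.dFun'_zero_mem_left h p⟩,
    ((c.continuous_dFun' h).comp (Continuous.prodMk_right 0)).subtype_mk _⟩
  invFun := ⟨Subtype.val, continuous_subtype_val⟩
  left_inv := ⟨{ toFun := fun x => c.dFun' h x.1 x.2
                 continuous_toFun := c.continuous_dFun' h
                 map_zero_left := fun p => rfl
                 map_one_left := fun p => c.dFun'_one h p }⟩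
  right_inv := by
    have h' : (⟨fun p => ⟨c.dFun' h 0 p, c.dFun'_zero_mem_left h p⟩,
        ((c.continuous_dFun' h).comp (Continuous.prodMk_right 0)).subtype_mk _⟩ : C(P, c.left)).comp
        ⟨Subtype.val, continuous_subtype_val⟩ = ContinuousMap.id c.left := by
      ext x
      exact c.dFun'_of_mem_left h 0 x.2
    rw [h']

omit [Nonempty A] in
/-- **`P ≃ X'` from a homotopy equivalence `A ≃ₕ Y'` realising the inclusion** (no nonemptiness
assumption: if `A` is empty then so is `Y'`, and `P = X'`). Hatcher (2002), Cor. 0.20.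
[cite: HatcherAT2002, Cor. 0.20] -/
theorem nonempty_homotopyEquiv_left (h : c.InclHomotopyInverse) :
    Nonempty (ContinuousMap.HomotopyEquiv P c.left) := by
  rcases isEmpty_or_nonempty A with hA | hA
  · -- `Y'` is empty (it maps to `A`), so `X' = P`
    have hright : c.right = ∅ := by
      ext z
      simp only [mem_empty_iff_false, iff_false]
      exact fun hz => isEmptyElim (h.inv ⟨z, hz⟩)
    have hleft : c.left = univ := by
      have := c.union_eq
      rwa [hright, union_empty] at this
    refine ⟨{ toFun := ⟨fun p => ⟨p, hleft ▸ mem_univ p⟩, continuous_id.subtype_mk _⟩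
              invFun := ⟨Subtype.val, continuous_subtype_val⟩
              left_inv := ?_
              right_inv := ?_ }⟩
    · exact ContinuousMap.Homotopic.refl _
    · have : (⟨fun p => ⟨p, hleft ▸ mem_univ p⟩, continuous_id.subtype_mk _⟩ : C(P, c.left)).comp
          ⟨Subtype.val, continuous_subtype_val⟩ = ContinuousMap.id c.left := by
        ext x; rfl
      rw [this]
  · exact ⟨c.homotopyEquivLeftOfInclHomotopyInverse h⟩

omit [Nonempty A] in
/-- **A space covered by two closed pieces, one contractible and the other homotopy equivalent —
through the collared inclusion of their intersection — to that intersection, is contractible.**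
This is "if `Sⁿ` is a deformation retract of `W` then `W' = W ∪ Dⁿ⁺¹` is contractible"
(Kervaire–Milnor 1963, proof of Lemma 2.3, p. 506) in the form needed for h-cobordisms in Milnor's
sense; Hatcher (2002), Cor. 0.20 with Example 0.15.
[cite: HatcherAT2002, Cor. 0.20] [cite: KervaireMilnorAnnals1963, Lemma 2.3, proof (p. 506)] -/
theorem contractibleSpace_of_inclHomotopyInverse (h : c.InclHomotopyInverse)
    (hleft : ContractibleSpace c.left) : ContractibleSpace P := by
  obtain ⟨e⟩ := c.nonempty_homotopyEquiv_left h
  exact e.contractibleSpace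

omit [Nonempty A] in
/-- The same, with the homotopy equivalence given as a Mathlib `HomotopyEquiv A Y'` whose forward
map is the collared inclusion. [cite: HatcherAT2002, Cor. 0.20] -/
theorem contractibleSpace_of_homotopyEquiv (e : ContinuousMap.HomotopyEquiv A c.right)
    (he : ∀ a, e.toFun a = c.incl a) (hleft : ContractibleSpace c.left) : ContractibleSpace P :=
  c.contractibleSpace_of_inclHomotopyInverse (InclHomotopyInverse.ofHomotopyEquiv c e he) hleft

end CollaredCover

end Literature.AlgebraicTopology.Homotopy
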